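import Summits.ResolutionOfSingularities.ResolutionOfSingularities.Theorems.EquisingularLiftEquisingularLiftNatSubmaxLinePrime
import Summits.ResolutionOfSingularities.ResolutionOfSingularities.Theorems.EquisingularLiftEquisingularLiftNatELNatAtLinSubst
import Summits.ResolutionOfSingularities.ResolutionOfSingularities.Theorems.EquisingularLiftEquisingularLiftNatResidualDegreeThree
import HarnessLib

/-!
# [OURS · EL♮(3)] SURFACES IN `ℙ³` WITH A LINE OF SUBMAXIMAL MULTIPLICITY — ANY LINE, ANY EMBEDDING: EL♮ for every `(H, ι)` whose image is
# `V₊(F)` with `F` prime and `σ_{τ'} F = x₀·A(x₂,x₃) + x₁·B(x₂,x₃) + C(x₂,x₃)` in SOME linear coordinate system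
# (crux `Theses.EquisingularLift.EquisingularLiftNatThree`, stmt-ResolutionOfSingularities-20148; parent EL♮ stmt-…-20038)

[OURS · leafhand-res-equisingularlift-7 g0, 2026-08-31; cell `pub/decomp-res`] AI-produced, weaker than expert review; NOT a statement of any
manuscript; nothing here proves resolution of singularities in positive characteristic.  DEF-FREE helper; no `sorry`; standard axioms; ZERO named
hypotheses.

`…NatSubmaxLinePrime` certified EL♮ for `V₊(F)`, `F` PRIME of the shape `x₀·A(x₂,x₃) + x₁·B(x₂,x₃) + C(x₂,x₃)` (a surface of degree `d + 2` with the
COORDINATE line `V(x₂, x₃)` of multiplicity `≥ d + 1`), with its standard embedding.  This file moves the line and the embedding: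

* `primeAlgEquiv` / `prime_aeval_of_prime` — mutually inverse linear substitutions `τ, τ'` give a `k`-algebra automorphism `σ_{τ'}` of `k[x₀,…,x₃]`,
  so `σ_{τ'} F` is prime with `F`;
* ★★ **`elNatAt_of_linSubst_submaxLine`** — for mutually inverse linear substitutions `τ, τ'`, a closed immersion `ι : H ⟶ ℙ³_k` with
  `range ι = V₊(F)`, `F` prime, and `σ_{τ'} F = x₀·A(x₂,x₃) + x₁·B(x₂,x₃) + C(x₂,x₃)` (`A, B` binary forms of degree `d + 1`, `C` of degree `d + 2`):
  `ELNatAt p k 3 H ι`, `k` algebraically closed of characteristic `p`, ANY `p` (✓ `QuadricELNat.elNatAt_of_elNatAt_linSubst`, p820173, over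
  ✓ `SubmaxLine.elNatAt_of_prime`).  In words: **every integral surface of degree `e ≥ 2` in `ℙ³_k̄` having SOME line of multiplicity `e − 1` satisfies
  EL♮** — the line and the shape being exhibited by a linear change of coordinates (normal-form input, as for the quadrics).

* `elnatO_of_linSubst_submaxLine` — the same in the registered stubs' currency `ELNatConclusionO` (✓ `RouteCurrency.elnatO_of_elNatAt`);
* ★ `equisingularLiftNatThree_of_forall_elnatO_off_submaxLine` — the route decl `Theses.EquisingularLift.EquisingularLiftNatThree`
  (stmt-…-20148) RE-CUT BY NAME: it holds as soon as `ELNatConclusionO` is known for the non-regular integral surfaces cut out by prime forms of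
  degree `e ≥ 3` in `ℙ³` that are NOT, in any linear coordinates, of the shape `x₀·A + x₁·B + C(x₂,x₃)` (pure reduction over ✓
  `QuadricELNat.equisingularLiftNatThree_of_forall_elnatO_primeForms_three_le`, p820141).

Residual of EL♮(3) after this file (honest): non-regular integral surfaces of degree `e ≥ 3` WITHOUT a line of multiplicity `e − 1` — for cubics:
exactly the NORMAL cubic surfaces with isolated singularities that are not cones (rational double point configurations) and … nothing else among the
non-normal ones (a non-normal integral cubic surface is singular along a line, of multiplicity `2 = e − 1`; classification quoted, not formalised).
-/

set_option linter.dupNamespace false -- mandated namespace `Summit.<Summit>.<Problem>` of this single-conjunct summit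

noncomputable section

open CategoryTheory CategoryTheory.Limits AlgebraicGeometry TopologicalSpace
open MvPolynomial
open Literature.AlgebraicGeometry.Resolution
open Literature.AlgebraicGeometry.Motives Literature.AlgebraicGeometry.Motives.SmoothHypersurface
open Literature.AlgebraicGeometry.Motives.ProjectiveSpace

namespace Summit.ResolutionOfSingularities.ResolutionOfSingularities.Cruxes.EquisingularLiftNat.Sections

namespace SubmaxLine

variable {k : Type} [Field k] {N : ℕ} (τ τ' : Fin N → MvPolynomial (Fin N) k)
  (hinv : ∀ i, aeval τ (τ' i) = X i) (hinv' : ∀ i, aeval τ' (τ i) = X i)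

/-! ## Linear substitutions preserve primality -/

include hinv hinv' in
/-- Mutually inverse substitutions `τ, τ'` make `σ_{τ'} = aeval τ'` a `k`-algebra automorphism of `k[x]` (inverse `aeval τ`). [folklore] -/
theorem exists_algEquiv_aeval : ∃ e : MvPolynomial (Fin N) k ≃ₐ[k] MvPolynomial (Fin N) k, ∀ G, e G = aeval τ' G := by
  have h₁ : (aeval τ' : MvPolynomial (Fin N) k →ₐ[k] MvPolynomial (Fin N) k).comp (aeval τ) = AlgHom.id k _ := by
    apply MvPolynomial.algHom_ext
    intro i
    rw [AlgHom.comp_apply, aeval_X, AlgHom.id_apply]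
    exact hinv' i
  have h₂ : (aeval τ : MvPolynomial (Fin N) k →ₐ[k] MvPolynomial (Fin N) k).comp (aeval τ') = AlgHom.id k _ := by
    apply MvPolynomial.algHom_ext
    intro i
    rw [AlgHom.comp_apply, aeval_X, AlgHom.id_apply]
    exact hinv i
  exact ⟨AlgEquiv.ofAlgHom (aeval τ') (aeval τ) h₁ h₂, fun G => rfl⟩

include hinv hinv' in
/-- **`σ_{τ'} F` is prime with `F`.** [folklore] -/
theorem prime_aeval_of_prime {F : MvPolynomial (Fin N) k} (hF : Prime F) : Prime (aeval τ' F) := by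
  obtain ⟨e, he⟩ := exists_algEquiv_aeval τ τ' hinv hinv'
  rw [← he]
  exact (MulEquiv.prime_iff e.toMulEquiv).mpr hF

/-! ## EL♮ in any linear coordinates -/

/-- ★★ **EL♮ FOR EVERY INTEGRAL SURFACE OF DEGREE `d + 2` IN `ℙ³` WITH A LINE OF MULTIPLICITY `≥ d + 1` — IN ANY COORDINATES, FOR ANY EMBEDDING.**
For mutually inverse linear substitutions `τ, τ'` of `k[x₀, …, x₃]` (`k` algebraically closed of characteristic `p`, ANY `p`), a closed immersion
`ι : H ⟶ ℙ³_k` with `range ι = V₊(F)`, `F` prime, and `σ_{τ'} F = x₀·A(x₂,x₃) + x₁·B(x₂,x₃) + C(x₂,x₃)` with `A, B` binary forms of degree `d + 1` and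
`C` a binary form of degree `d + 2`: `Theorems.EquisingularLift.ELNatAt p k 3 H ι` (✓ `SubmaxLine.elNatAt_of_prime` transported by
✓ `QuadricELNat.elNatAt_of_elNatAt_linSubst`).  For `d = 1`: every integral cubic surface singular along a line, in any position.
[OURS · lh7] [cite: Hartshorne1977, I Ex. 5.12] -/
theorem elNatAt_of_linSubst_submaxLine (p : ℕ) (hp : p.Prime) [CharP k p] [IsAlgClosed k]
    (τ τ' : Fin (2 + 1 + 1) → MvPolynomial (Fin (2 + 1 + 1)) k)
    (hτ : ∀ i, (τ i).IsHomogeneous 1) (hτ' : ∀ i, (τ' i).IsHomogeneous 1)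
    (hinv : ∀ i, aeval τ (τ' i) = X i) (hinv' : ∀ i, aeval τ' (τ i) = X i)
    {d : ℕ} (A B C : MvPolynomial (Fin 2) k) (hA : A.IsHomogeneous (d + 1)) (hB : B.IsHomogeneous (d + 1))
    (hC : C.IsHomogeneous (d + 2))
    {H : Scheme.{0}} (ι : H ⟶ (projectiveSpace (2 + 1) k).left) [IsClosedImmersion ι] (F : MvPolynomial (Fin (2 + 1 + 1)) k)
    (hprime : Prime F)
    (hshape : aeval τ' F =
      X 0 * rename (![2, 3] : Fin 2 → Fin 4) A + X 1 * rename (![2, 3] : Fin 2 → Fin 4) B + rename (![2, 3] : Fin 2 → Fin 4) C)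
    (hrange : letI := MvPolynomial.gradedAlgebra (σ := Fin (2 + 1 + 1)) (R := k)
      Set.range ι = {x : Proj (homogeneousSubmodule (Fin (2 + 1 + 1)) k) | F ∈ x.asHomogeneousIdeal}) :
    Theorems.EquisingularLift.ELNatAt p k (2 + 1) H ι :=
  QuadricELNat.elNatAt_of_elNatAt_linSubst τ τ' hτ hτ' hinv hinv' p ι F hrange
    (elNatAt_of_prime k A B C hA hB hC (aeval τ' F) hshape p hp (prime_aeval_of_prime τ τ' hinv hinv' hprime))

/-- **The same in the stubs' currency**: `ELNatConclusionO k 3 H ι` (✓ `RouteCurrency.elnatO_of_elNatAt`). [OURS · lh7] -/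
theorem elnatO_of_linSubst_submaxLine (p : ℕ) (hp : p.Prime) [CharP k p] [IsAlgClosed k]
    (τ τ' : Fin (2 + 1 + 1) → MvPolynomial (Fin (2 + 1 + 1)) k)
    (hτ : ∀ i, (τ i).IsHomogeneous 1) (hτ' : ∀ i, (τ' i).IsHomogeneous 1)
    (hinv : ∀ i, aeval τ (τ' i) = X i) (hinv' : ∀ i, aeval τ' (τ i) = X i)
    {d : ℕ} (A B C : MvPolynomial (Fin 2) k) (hA : A.IsHomogeneous (d + 1)) (hB : B.IsHomogeneous (d + 1))
    (hC : C.IsHomogeneous (d + 2))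
    {H : Scheme.{0}} (ι : H ⟶ (projectiveSpace (2 + 1) k).left) [hι : IsClosedImmersion ι] (hH : IsIntegral H)
    (F : MvPolynomial (Fin (2 + 1 + 1)) k) (hprime : Prime F)
    (hshape : aeval τ' F =
      X 0 * rename (![2, 3] : Fin 2 → Fin 4) A + X 1 * rename (![2, 3] : Fin 2 → Fin 4) B + rename (![2, 3] : Fin 2 → Fin 4) C)
    (hrange : letI := MvPolynomial.gradedAlgebra (σ := Fin (2 + 1 + 1)) (R := k)
      Set.range ι = {x : Proj (homogeneousSubmodule (Fin (2 + 1 + 1)) k) | F ∈ x.asHomogeneousIdeal}) :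
    ELNatConclusionO k (2 + 1) H ι :=
  RouteCurrency.elnatO_of_elNatAt p hp k (2 + 1) H ι hι hH
    (elNatAt_of_linSubst_submaxLine p hp τ τ' hτ hτ' hinv hinv' A B C hA hB hC ι F hprime hshape hrange)

/-- ★ **THE ROUTE DECL `EquisingularLiftNatThree` (stmt-…-20148) RE-CUT BY NAME AT THE SURFACES WITHOUT A LINE OF SUBMAXIMAL MULTIPLICITY**: it
holds as soon as `ELNatConclusionO` is known for every non-regular integral `H ⊆ ℙ³_k̄` cut out by a PRIME form `F` of degree `e ≥ 3` which, in NO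
linear coordinate system, takes the shape `x₀·A(x₂,x₃) + x₁·B(x₂,x₃) + C(x₂,x₃)` (`A, B` forms of degree `e − 1`, `C` of degree `e`) — the
submaximal-line surfaces being discharged by `elnatO_of_linSubst_submaxLine` in every characteristic.  Pure reduction over ✓
`QuadricELNat.equisingularLiftNatThree_of_forall_elnatO_primeForms_three_le` (p820141). [OURS · lh7 · DEF-FREE] [cite: Hartshorne1977, I Ex. 5.12] -/
theorem equisingularLiftNatThree_of_forall_elnatO_off_submaxLine
    (h : ∀ p : ℕ, p.Prime → ∀ (k : Type) [Field k] [CharP k p] [IsAlgClosed k] (H : Scheme.{0})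
      (ι : H ⟶ (Literature.AlgebraicGeometry.Motives.projectiveSpace 3 k).left), IsClosedImmersion ι → IsIntegral H →
      (∀ y : (Literature.AlgebraicGeometry.Motives.projectiveSpace 3 k).left,
        ∃ U : (Literature.AlgebraicGeometry.Motives.projectiveSpace 3 k).left.affineOpens,
          y ∈ (U : (Literature.AlgebraicGeometry.Motives.projectiveSpace 3 k).left.Opens) ∧ (ι.ker.ideal U).IsPrincipal) →
      ¬ Scheme.IsRegular H → ∀ (e : ℕ) (F : MvPolynomial (Fin (3 + 1)) k), 3 ≤ e → F.IsHomogeneous e → Prime F →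
      (letI := MvPolynomial.gradedAlgebra (σ := Fin (3 + 1)) (R := k)
       Set.range ι = {x : Proj (homogeneousSubmodule (Fin (3 + 1)) k) | F ∈ x.asHomogeneousIdeal}) →
      (∀ (τ τ' : Fin (3 + 1) → MvPolynomial (Fin (3 + 1)) k) (d : ℕ) (A B C : MvPolynomial (Fin 2) k),
        (∀ i, (τ i).IsHomogeneous 1) → (∀ i, (τ' i).IsHomogeneous 1) → (∀ i, aeval τ (τ' i) = X i) → (∀ i, aeval τ' (τ i) = X i) →
        A.IsHomogeneous (d + 1) → B.IsHomogeneous (d + 1) → C.IsHomogeneous (d + 2) →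
        aeval τ' F ≠ X 0 * rename (![2, 3] : Fin 2 → Fin (3 + 1)) A + X 1 * rename (![2, 3] : Fin 2 → Fin (3 + 1)) B +
          rename (![2, 3] : Fin 2 → Fin (3 + 1)) C) →
      ELNatConclusionO k 3 H ι) :
    Summit.ResolutionOfSingularities.ResolutionOfSingularities.Theses.EquisingularLift.EquisingularLiftNatThree := by
  refine QuadricELNat.equisingularLiftNatThree_of_forall_elnatO_primeForms_three_le ?_
  intro p hp k _ _ _ n H ι hι hH hloc hn hreg e F he hF hprime hrange
  subst hn
  by_cases hex : ∃ (τ τ' : Fin (3 + 1) → MvPolynomial (Fin (3 + 1)) k) (d : ℕ) (A B C : MvPolynomial (Fin 2) k),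
      (∀ i, (τ i).IsHomogeneous 1) ∧ (∀ i, (τ' i).IsHomogeneous 1) ∧ (∀ i, aeval τ (τ' i) = X i) ∧ (∀ i, aeval τ' (τ i) = X i) ∧
      A.IsHomogeneous (d + 1) ∧ B.IsHomogeneous (d + 1) ∧ C.IsHomogeneous (d + 2) ∧
      aeval τ' F = X 0 * rename (![2, 3] : Fin 2 → Fin (3 + 1)) A + X 1 * rename (![2, 3] : Fin 2 → Fin (3 + 1)) B +
        rename (![2, 3] : Fin 2 → Fin (3 + 1)) C
  · obtain ⟨τ, τ', d, A, B, C, hτ, hτ', hinv, hinv', hA, hB, hC, hshape⟩ := hex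
    haveI := hι
    exact elnatO_of_linSubst_submaxLine p hp τ τ' hτ hτ' hinv hinv' A B C hA hB hC ι hH F hprime hshape hrange
  · push Not at hex
    exact h p hp k H ι hι hH hloc hreg e F he hF hprime hrange
      (fun τ τ' d A B C hτ hτ' hinv hinv' hA hB hC => hex τ τ' d A B C hτ hτ' hinv hinv' hA hB hC)

end SubmaxLine

end Summit.ResolutionOfSingularities.ResolutionOfSingularities.Cruxes.EquisingularLiftNat.Sections

end
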